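import Literature.AlgebraicGeometry.Motives.JacobianBrillNoetherLocusAlteration
import Literature.AlgebraicGeometry.Motives.JacobianAbelSumFibres
import Literature.AlgebraicGeometry.Motives.WeilJacobianUniversal
import HarnessLib

/-!
# Lange's Lemma 4.2.1 (ii) over ANY algebraically closed field of characteristic zero:
# `dim W̃_n(P) = n` for every `n ≤ g(C)` — no Hodge theory, no `dim J = g`

Layer `Literature/AlgebraicGeometry/Motives` (namespaces `….Motives.CurvePlaces`, `….Motives.Jacobian`).  KERNEL ONLY (theorems; no definition,
no named fact, no instance, no `sorry`).

The tree's ★ `Jacobian.topologicalKrullDim_brillNoetherLocus_eq_of_le` (`Motives/JacobianBrillNoetherLocusDimensionLe` §2) is COMPLEX-ONLY: its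
`dim J`-fold uniqueness input (★ (γ) `exists_opens_general_abelSum_of_isSmoothProjective`) rests on the dimension count `dim J = g`, i.e. on Hodge
theory (★ `HodgeTheory.Jacobian.dim_le_curveGenus`).  Milne (*Jacobian Varieties* §5, Thm. 5.1 (a)) and Lange (§4.2.1 Lemma 4.2.1 (ii)) argue level
by level instead: for `n ≤ g` a GENERAL effective divisor `D` of degree `n` has `h⁰(D) = 1` (Lemma 5.2), so the fibre of `f^{(n)} : C^{(n)} → W^n`
through `D` is the single point `|D| = {D}`, and `f^{(n)}` is birational onto its image, which therefore has dimension `n`.  This file formalises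
exactly that, for EVERY Jacobian `𝒥 : Jacobian C` (universal property) of a smooth projective geometrically integral curve `C` over an algebraically
closed field `K` of characteristic `0` (the standing hypotheses of the tree's Weil construction, ★ `Motives/WeilJacobian*`):

* §1 **`CurvePlaces.exists_ell_sum_single_eq_one_of_le`** ∕ **`nonempty_generalLocus_of_sections_of_le`** ∕ **`nonempty_generalLocus_of_le`** — the
  general locus `{t ∈ Cⁿ : h⁰(Σ tᵢ) = 1}` (★ `CurvePlaces.generalLocus C n`) is NON-EMPTY for every `n ≤ g` (Milne Lemma 5.2: among `2g − 1` rational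
  points there are `n` with `h¹(Σ Pᵢ) = g − n`, ★ `exists_ell_canonical_sub_eq`, + Riemann–Roch ★ `riemann_roch_holds`); the tree had the case `n = g`
  only (★ `nonempty_generalLocus_of_sections`, ★ `exists_ell_sum_single_eq_one`).
* §2 **`Jacobian.exists_opens_uniqueOn_abelSum_of_le_curveGenus`** — for `n ≤ g` there is an open `U₁ ⊆ J` MEETING `W̃_n(P)` over which `n`-fold Abel
  sums are unique up to `𝔖_n`: `U₁ := J ∖ α_n(Cⁿ ∖ V)` with `V` the (open, ★ `isOpen_generalLocus`) general locus — `α_n` is proper hence closed;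
  a tuple `τ` with `h⁰(Σ τⱼ) = 1` has `α_n(τ) ∈ U₁` because every point of `Cⁿ` over `α_n(τ)` specialises to a CLOSED point over it, i.e. to a tuple
  with the same Abel sum, which is a permutation of `τ` (★ `Jacobian.exists_perm_of_prod_comp_abelJacobi_eq_of_ell_eq_one`, Milne Thm. 5.1 (a) on the
  `ℓ = 1` locus) and so lies in `V` again; uniqueness over `U₁` is the same ★ theorem.
* §3 **`Jacobian.topologicalKrullDim_brillNoetherLocus_eq_of_le_curveGenus`**: `dim W̃_n(P) = n` for every `n ≤ g(C)` — §2 fed to the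
  relative-uniqueness alteration theorem ★ `Jacobian.topologicalKrullDim_brillNoetherLocus_of_uniqueOn` (`Motives/JacobianBrillNoetherLocusAlteration`);
  **`brillNoetherLocus_ssubset_succ_of_lt_curveGenus`**: `W̃_r(P) ⊊ W̃_{r+1}(P)` for `r < g`; with ★ `Jacobian.dim_eq_curveGenus` (Milne Prop. 2.1,
  field-general in the tree): **`brillNoetherLocus_eq_univ_of_curveGenus_le`** (`W̃_r(P) = J` for `r ≥ g`, Lemma 4.2.1 (i)) and
  **`exists_tuple_prod_comp_abelJacobi_eq_of_curveGenus_le`** (`f^{(r)}` is surjective on `K`-points for `r ≥ g`).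

Use (cell `hodgecm-mathlib`, D-0151; crux HLiu418 = stmt-HodgeConjecture-24832; Brill–Noether ∕ theta-divisor capital next to rows VI-7∕VI-8, now
field-general in characteristic `0`).  COUNT-NEUTRAL.  HC_CM is proved only modulo the 7 printed citations until rung 0 closes; this file moves no book.

## References
* [Milne1986JacobianVarieties] J. S. Milne, *Jacobian Varieties*, in Cornell–Silverman (1986), §5 Lemma 5.2 and Thm. 5.1 (a).
* [Lange2023AbelianVarietiesComplex] H. Lange, *Abelian Varieties over the Complex Numbers* (2023), §4.2.1 Lemma 4.2.1 (i), (ii).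
* [Stichtenoth2009] H. Stichtenoth, *Algebraic Function Fields and Codes* (2009), Thm. I.5.15 (Riemann–Roch).
-/

set_option autoImplicit false

noncomputable section

universe u v

open CategoryTheory CategoryTheory.Limits AlgebraicGeometry MonoidalCategory CartesianMonoidalCategory TopologicalSpace
open Literature.NumberTheory.DiophantineGeometry Literature.NumberTheory.DiophantineGeometry.AlgFunctionField
open Literature.AlgebraicGeometry.RelativeSpec

namespace Literature.AlgebraicGeometry.Motives

/-! ## §1 Non-special effective divisors of every degree `n ≤ g` on rational places; the general locus of `Cⁿ` is non-empty -/

namespace CurvePlaces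

open RatFn FieldPoint CartierDivisor

section FunctionField

variable {K : Type u} {F : Type v} [Field K] [Field F] [Algebra K F]

/-- **Milne's Lemma 5.2 at every level `r ≤ g`**: given `≥ 2g − 1` rational places, for every `r ≤ g` there are `P₁, …, P_r` among them with
`ℓ(Σ Pᵢ) = 1` — ★ `exists_ell_canonical_sub_eq` gives `ℓ(W − Σ Pᵢ) = g − r`, and Riemann–Roch (★ `riemann_roch_holds`) turns it into
`ℓ(Σ Pᵢ) = r + 1 − g + (g − r) = 1`.  (★ `exists_ell_sum_single_eq_one` is the case `r = g`.)
[cite: Milne1986JacobianVarieties, §5 Lemma 5.2] [cite: Stichtenoth2009, Thm. I.5.15] -/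
theorem exists_ell_sum_single_eq_one_of_le [IsAlgFunctionField K F] [IsIntegrallyClosedIn K F]
    (S : Finset (PlaceOver K F)) (hS : ∀ v ∈ S, v.degree = 1)
    (hcard : 2 * genus K F ≤ S.card + 1) {r : ℕ} (hr : r ≤ genus K F) :
    ∃ v : Fin r → PlaceOver K F, (∀ i, v i ∈ S) ∧
      ell (∑ i, Finsupp.single (v i) (1 : ℤ)) = 1 := by
  obtain ⟨W, hW, hRR⟩ := riemann_roch_holds (K := K) (F := F)
  obtain ⟨v, hvS, hv⟩ := exists_ell_canonical_sub_eq hW S hS hcard r hr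
  refine ⟨v, hvS, ?_⟩
  have h := hRR (∑ i, Finsupp.single (v i) 1)
  rw [degree_sum_single_of_degree_eq_one v fun i ↦ hS _ (hvS i)] at h
  have hv' : ((ell (W - ∑ i, Finsupp.single (v i) (1 : ℤ)) : ℕ) : ℤ) + r = genus K F := by
    exact_mod_cast hv
  have : (ell (∑ i, Finsupp.single (v i) (1 : ℤ)) : ℤ) = 1 := by linarith
  exact_mod_cast this

end FunctionField

section Sections

variable {L : Type u} [Field L] (X : SchemeOver L) [IsIntegral X.left]
  [SmoothOfRelativeDimension 1 X.hom] [IsProper X.hom] [GeometricallyIntegral X.hom]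

/-- **The general locus `{h⁰(Σ tᵢ) = 1} ⊆ Xʳ` is non-empty for every `r ≤ g`, given `2g − 1` distinct sections** (Milne Lemma 5.2 (b) with
Prop. 4.2 (a)): §1 on the rational places of the sections, then ★ `imagePtPow_tuplePt_mem_generalLocus`.  (★ `nonempty_generalLocus_of_sections`
is the case `r = g`; same proof.) [cite: Milne1986JacobianVarieties, §5 Lemma 5.2 (b)] -/
theorem nonempty_generalLocus_of_sections_of_le {N : ℕ} (s : Fin N → (Over.mk (𝟙 (Spec (.of L))) ⟶ X))
    (hs : Function.Injective s) (hN : 2 * curveGenus X ≤ N + 1) {r : ℕ} (hr : r ≤ curveGenus X) :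
    (generalLocus X r).Nonempty := by
  classical
  set X'' := curveBC X (𝟙 (Spec (.of L)))
  have hg : curveGenus X'' = curveGenus X := curveGenus_curveBC_id X
  let pl : Fin N → PlaceOver L X''.left.functionField := fun j ↦
    place X'' (ratPtPoint X (𝟙 _) (s j)) (ratPtPoint_ne_genericPoint X _ (s j))
  have hpl : Function.Injective pl := fun j₁ j₂ h ↦
    hs (ratPtPoint_id_injective X (place_injective (C := X'') _ _ h))
  set S : Finset (PlaceOver L X''.left.functionField) := Finset.univ.image pl
  have hScard : S.card = N := by
    rw [Finset.card_image_of_injective _ hpl, Finset.card_univ, Fintype.card_fin]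
  have hSdeg : ∀ v ∈ S, v.degree = 1 := by
    intro v hv
    obtain ⟨j, -, rfl⟩ := Finset.mem_image.1 hv
    exact degree_place_ratPtPoint X (s j)
  have hcard : 2 * genus L X''.left.functionField ≤ S.card + 1 := by
    rw [hScard]
    change 2 * curveGenus X'' ≤ N + 1
    rwa [hg]
  have hr' : r ≤ genus L X''.left.functionField := by
    change r ≤ curveGenus X''
    rwa [hg]
  obtain ⟨v, hvS, hv⟩ := exists_ell_sum_single_eq_one_of_le (K := L) S hSdeg hcard hr'
  -- indices `j i` with `v i = pl (j i)`
  have hj : ∀ i, ∃ j, pl j = v i := fun i ↦ by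
    obtain ⟨j, -, hj⟩ := Finset.mem_image.1 (hvS i)
    exact ⟨j, hj⟩
  choose j hj using hj
  have hmem := imagePtPow_tuplePt_mem_generalLocus X (𝟙 _) (fun i ↦ s (j i)) (by
    have : (fun i ↦ Finsupp.single (place (curveBC X (𝟙 _)) (ratPtPoint X (𝟙 _) (s (j i)))
        (ratPtPoint_ne_genericPoint X _ _)) (1 : ℤ)) = fun i ↦ Finsupp.single (v i) 1 := by
      funext i
      exact congrArg (Finsupp.single · (1 : ℤ)) (hj i)
    simp only [this]
    exact hv)
  exact ⟨_, hmem⟩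

end Sections

section AlgClosed

variable {K : Type u} [Field K] [IsAlgClosed K] (C : SchemeOver K) [IsIntegral C.left]
  [SmoothOfRelativeDimension 1 C.hom] [IsProper C.hom] [GeometricallyIntegral C.hom]

/-- **Over an algebraically closed field the general locus of `Cʳ` is non-empty for every `r ≤ g`**: `C` has infinitely many `K`-points
(★ `infinite_algPoints`), so `2g − 1` distinct sections exist. [cite: Milne1986JacobianVarieties, §5 Lemma 5.2 (b)] -/
theorem nonempty_generalLocus_of_le {r : ℕ} (hr : r ≤ curveGenus C) : (generalLocus C r).Nonempty := by
  haveI := infinite_algPoints C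
  let a := Infinite.natEmbedding (AlgPoints C K)
  let s : Fin (2 * curveGenus C) → (𝟙_ (SchemeOver K) ⟶ C) := fun j ↦ unitToSpecOver K ≫ a j
  have hs : Function.Injective s := fun j₁ j₂ h ↦ by
    have h' := congrArg (toUnit (specOver K K) ≫ ·) h
    simp only [s] at h'
    rw [← Category.assoc, toUnit_unitToSpecOver, Category.id_comp, ← Category.assoc, toUnit_unitToSpecOver,
      Category.id_comp] at h'
    exact Fin.val_injective (a.injective h')
  exact nonempty_generalLocus_of_sections_of_le C s hs (by omega) hr

omit [IsAlgClosed K] in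
/-- **A `K`-point `(τ₁, …, τ_n)` of `Cⁿ` is general iff `ℓ(Σⱼ [τⱼ]) = 1`** (★ `imagePtPow_mem_generalLocus_iff` at the `K`-point `tuplePt τ = liftOver τ`,
★ `coordDivisorAt_tuplePt_eq_tupleDiv`). [cite: Milne1986JacobianVarieties, §4 Prop. 4.2 (a)] -/
theorem pt_liftOver_mem_generalLocus_iff {n : ℕ} (τ : Fin n → AlgPoints C K) :
    AlgPoints.pt (liftOver C.hom n τ : AlgPoints (powC C n) K) ∈ generalLocus C n ↔ ell (tupleDiv C τ) = 1 := by
  rw [← coordDivisorAt_tuplePt_eq_tupleDiv C τ]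
  exact imagePtPow_mem_generalLocus_iff C n (strPt (K := K) K) (tuplePt C _ τ)

omit [IsAlgClosed K] [IsIntegral C.left] in
/-- `Σⱼ [τ_{σ j}] = Σⱼ [τⱼ]` for a permutation `σ` (the divisor of a tuple depends only on its image in the symmetric power).
[cite: Milne1986JacobianVarieties, §3 Prop. 3.1] -/
theorem tupleDiv_comp_perm {n : ℕ} (τ : Fin n → AlgPoints C K) (σ : Equiv.Perm (Fin n)) :
    tupleDiv C (τ ∘ σ) = tupleDiv C τ :=
  Equiv.sum_comp σ (fun j => ptDiv C (τ j))

end AlgClosed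

end CurvePlaces

/-! ## §2 The open `U₁ = J ∖ α_n(Cⁿ ∖ V)` of uniqueness, meeting `W̃_n(P)`, for every `n ≤ g` -/

namespace Jacobian

open CurvePlaces

variable {K : Type u} [Field K] [IsAlgClosed K] [CharZero K] {C : SchemeOver K} [IsIntegral C.left]
  [SmoothOfRelativeDimension 1 C.hom] [IsProper C.hom] [GeometricallyIntegral C.hom]
  (𝒥 : Jacobian C) (hC : IsProjectiveOver C) (P : AlgPoints C K)

include hC in
/-- **For every `n ≤ g(C)` there is an open `U₁ ⊆ J` meeting `W̃_n(P)` over which `n`-fold Abel sums are unique up to `𝔖_n`** (Milne §5 Thm. 5.1 (a):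
`f^{(n)} : C^{(n)} → W^n` is injective on the open `h⁰ = 1` locus, which is non-empty for `n ≤ g` by Lemma 5.2).  `U₁ := J ∖ α_n(Cⁿ ∖ V)` where
`V = {h⁰(Σ τⱼ) = 1}` is the general locus (open ★ `isOpen_generalLocus`, non-empty §1) and `α_n` is proper, hence closed.  For a tuple `τ` with
`h⁰(Σ τⱼ) = 1`, `α_n(τ) ∉ α_n(Cⁿ ∖ V)`: a point `t′` of the closed set `Cⁿ ∖ V` over `α_n(τ)` specialises to a closed point of `Cⁿ ∖ V` over `α_n(τ)`
(`Cⁿ` is Jacobson), i.e. to a tuple `τ″` with `∏ f^P(τ″ⱼ) = ∏ f^P(τⱼ)`, which is a permutation of `τ` (★ `exists_perm_of_prod_comp_abelJacobi_eq_of_ell_eq_one`)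
and hence general — contradiction.  Uniqueness over `U₁`: a tuple with Abel sum in `U₁` is general, and the same ★ theorem applies.  (`n = 0`: `U₁ = J`.)
[cite: Milne1986JacobianVarieties, §5 Thm. 5.1 (a) and Lemma 5.2] [cite: Lange2023AbelianVarietiesComplex, §4.2.1 Lemma 4.2.1 (ii)] -/
theorem exists_opens_uniqueOn_abelSum_of_le_curveGenus {n : ℕ} (hn : n ≤ curveGenus C) :
    ∃ U₁ : 𝒥.J.X.left.Opens, ((U₁ : Set 𝒥.J.X.left) ∩ 𝒥.brillNoetherLocus P n).Nonempty ∧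
      ∀ τ τ' : Fin n → AlgPoints C K, ((∏ j : Fin n, τ j ≫ 𝒥.abelJacobi P : 𝒥.J.Points K)).pt ∈ U₁ →
        (∏ j : Fin n, τ' j ≫ 𝒥.abelJacobi P) = (∏ j : Fin n, τ j ≫ 𝒥.abelJacobi P) →
          ∃ σ : Equiv.Perm (Fin n), τ' = τ ∘ σ := by
  classical
  haveI : LocallyOfFiniteType 𝒥.J.X.hom := 𝒥.J.isProper.toLocallyOfFiniteType
  rcases Nat.eq_zero_or_pos n with rfl | hnpos
  · -- level `0`: `W̃_0(P) = {0}` and `Fin 0`-tuples are all equal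
    refine ⟨⊤, ⟨((1 : 𝒥.J.Points K)).pt, trivial, ?_⟩, fun τ τ' _ _ => ⟨1, funext fun j => j.elim0⟩⟩
    exact (𝒥.pt_mem_brillNoetherLocus_iff P 0 1).mpr ⟨Fin.elim0, by simp⟩
  have hpos : 1 ≤ curveGenus C := le_trans hnpos hn
  haveI : JacobsonSpace (powC C n).left := LocallyOfFiniteType.jacobsonSpace (powC C n).hom
  have hX : CechPseudoCoherentAt C := cechPseudoCoherentAt_of_general cechComplex_pseudoCoherent_general_holds C
  -- the general locus `V ⊆ Cⁿ`: open and non-empty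
  have hVopen : IsOpen (generalLocus C n) := isOpen_generalLocus C n hX
  have hVne : (generalLocus C n).Nonempty := nonempty_generalLocus_of_le C hn
  -- `α_n` is proper, hence a closed map
  haveI : IsProper ((𝒥.abelSum P n).left ≫ 𝒥.J.X.hom) := by
    rw [Over.w (𝒥.abelSum P n)]
    exact isProper_powOver_base C.hom n
  haveI : IsProper (𝒥.abelSum P n).left := IsProper.of_comp (𝒥.abelSum P n).left 𝒥.J.X.hom
  -- a `K`-point of `Cⁿ` is the tuple of its coordinates; its Abel sum
  have hcoords : ∀ ω : AlgPoints (powC C n) K,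
      ω = liftOver C.hom n (fun j => ω ≫ (projOver C.hom n j : powOverObj C.hom n ⟶ C)) :=
    fun ω => hom_ext_projOver C.hom n _ _ fun j =>
      (liftOver_projOver C.hom n (fun j => ω ≫ (projOver C.hom n j : powOverObj C.hom n ⟶ C)) j).symm
  have hαlift : ∀ τ : Fin n → AlgPoints C K,
      ((∏ j : Fin n, τ j ≫ 𝒥.abelJacobi P : 𝒥.J.Points K)).pt =
        (𝒥.abelSum P n).left.base (AlgPoints.pt (liftOver C.hom n τ : AlgPoints (powC C n) K)) := by
    intro τ
    rw [← 𝒥.liftOver_comp_abelSum P n τ]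
    rfl
  -- the closed set `F = α_n(Cⁿ ∖ V)` and the open `U₁ = J ∖ F`
  set F : Set 𝒥.J.X.left := (𝒥.abelSum P n).left.base '' (generalLocus C n)ᶜ with hF
  have hFcl : IsClosed F := (𝒥.abelSum P n).left.isClosedMap _ hVopen.isClosed_compl
  -- KEY: the Abel sum of a general tuple avoids `F`
  have hkey : ∀ τ : Fin n → AlgPoints C K, ell (tupleDiv C τ) = 1 →
      ((∏ j : Fin n, τ j ≫ 𝒥.abelJacobi P : 𝒥.J.Points K)).pt ∉ F := by
    intro τ hτ hmem
    obtain ⟨t', ht'V, ht'⟩ := hmem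
    set x : 𝒥.J.Points K := ∏ j : Fin n, τ j ≫ 𝒥.abelJacobi P with hx
    -- the closure of `t'` stays in `Cⁿ ∖ V` and over `x`; it contains a closed point, i.e. a `K`-point `ω`
    have hZ1 : closure ({t'} : Set (powC C n).left) ⊆ (generalLocus C n)ᶜ :=
      closure_minimal (Set.singleton_subset_iff.mpr ht'V) hVopen.isClosed_compl
    have hZ2 : closure ({t'} : Set (powC C n).left) ⊆ (𝒥.abelSum P n).left.base ⁻¹' {x.pt} :=
      closure_minimal (Set.singleton_subset_iff.mpr ht')
        (x.isClosed_singleton_pt.preimage (𝒥.abelSum P n).left.continuous)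
    obtain ⟨t'', ht''Z, ht''cl⟩ := nonempty_inter_closedPoints (Z := closure ({t'} : Set (powC C n).left))
      ⟨t', subset_closure rfl⟩ isClosed_closure.isLocallyClosed
    obtain ⟨ω, hω⟩ := AlgPoints.exists_pt_eq_of_isClosed_singleton (X := powC C n) (mem_closedPoints_iff.mp ht''cl)
    set τ'' : Fin n → AlgPoints C K := fun j => ω ≫ (projOver C.hom n j : powOverObj C.hom n ⟶ C) with hτ''def
    have hωeq : ω = liftOver C.hom n τ'' := hcoords ω
    -- `ω` has the same Abel sum as `τ`, hence is a permutation of `τ`, hence general: contradiction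
    have hprod : (∏ j : Fin n, τ'' j ≫ 𝒥.abelJacobi P) = x := by
      apply AlgPoints.eq_of_pt_eq
      rw [hαlift τ'', ← hωeq, hω]
      exact hZ2 ht''Z
    obtain ⟨σ, hσ⟩ := 𝒥.exists_perm_of_prod_comp_abelJacobi_eq_of_ell_eq_one hC hpos P τ hτ τ'' hprod
    have hω'' : ω.pt ∈ generalLocus C n := by
      rw [hωeq, pt_liftOver_mem_generalLocus_iff, hσ, tupleDiv_comp_perm]
      exact hτ
    exact hZ1 ht''Z (by rw [← hω]; exact hω'')
  refine ⟨⟨Fᶜ, hFcl.isOpen_compl⟩, ?_, ?_⟩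
  · -- `U₁` meets `W̃_n(P)`: the Abel sum of a `K`-point of `V`
    obtain ⟨t, htV, htcl⟩ := nonempty_inter_closedPoints hVne hVopen.isLocallyClosed
    obtain ⟨ω, hω⟩ := AlgPoints.exists_pt_eq_of_isClosed_singleton (X := powC C n) (mem_closedPoints_iff.mp htcl)
    set τ : Fin n → AlgPoints C K := fun j => ω ≫ (projOver C.hom n j : powOverObj C.hom n ⟶ C) with hτdef
    have hωeq : ω = liftOver C.hom n τ := hcoords ω
    have hτ : ell (tupleDiv C τ) = 1 := by
      rw [← pt_liftOver_mem_generalLocus_iff, ← hωeq, hω]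
      exact htV
    exact ⟨((∏ j : Fin n, τ j ≫ 𝒥.abelJacobi P : 𝒥.J.Points K)).pt, hkey τ hτ,
      (𝒥.pt_mem_brillNoetherLocus_iff P n _).mpr ⟨τ, rfl⟩⟩
  · -- uniqueness over `U₁`: a tuple with Abel sum outside `F` is general
    intro τ τ' hτU h
    have hτU' : ((∏ j : Fin n, τ j ≫ 𝒥.abelJacobi P : 𝒥.J.Points K)).pt ∉ F := hτU
    have hτ : ell (tupleDiv C τ) = 1 := by
      by_contra hne
      exact hτU' ⟨AlgPoints.pt (liftOver C.hom n τ : AlgPoints (powC C n) K),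
        fun hV => hne ((pt_liftOver_mem_generalLocus_iff C τ).mp hV), (hαlift τ).symm⟩
    exact 𝒥.exists_perm_of_prod_comp_abelJacobi_eq_of_ell_eq_one hC hpos P τ hτ τ' h

/-! ## §3 `dim W̃_n(P) = n` for every `n ≤ g(C)`; `W̃_r ⊊ W̃_{r+1}` for `r < g`; `W̃_r = J` and `f^{(r)}` onto for `r ≥ g` -/

include hC in
/-- **Lange's Lemma 4.2.1 (ii) ∕ Milne Thm. 5.1 (a) over any algebraically closed field of characteristic `0`: `dim W̃_n(P) = n` for every
`n ≤ g(C)`**, for every Jacobian of a smooth projective geometrically integral curve and every base point — §2 fed to the relative-uniqueness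
alteration theorem ★ `topologicalKrullDim_brillNoetherLocus_of_uniqueOn` (with `s = 0`).  No Hodge theory and no `dim J = g` is used.
[cite: Lange2023AbelianVarietiesComplex, §4.2.1 Lemma 4.2.1 (ii)] [cite: Milne1986JacobianVarieties, §5 Thm. 5.1 (a)] -/
theorem topologicalKrullDim_brillNoetherLocus_eq_of_le_curveGenus {n : ℕ} (hn : n ≤ curveGenus C) :
    topologicalKrullDim ↥(𝒥.brillNoetherLocus P n) = (n : WithBot ℕ∞) :=
  𝒥.topologicalKrullDim_brillNoetherLocus_of_uniqueOn P n 0 (Nat.add_zero n)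
    (𝒥.exists_opens_uniqueOn_abelSum_of_le_curveGenus hC P hn)

include hC in
/-- **`W̃_r(P) ⊊ W̃_{r+1}(P)` for `r < g(C)`** (their dimensions are `r` and `r + 1`; Lange Lemma 4.2.1 (i)–(ii)), any algebraically closed field
of characteristic `0`. [cite: Lange2023AbelianVarietiesComplex, §4.2.1 Lemma 4.2.1 (i) and (ii)] -/
theorem brillNoetherLocus_ssubset_succ_of_lt_curveGenus {r : ℕ} (hr : r < curveGenus C) :
    𝒥.brillNoetherLocus P r ⊂ 𝒥.brillNoetherLocus P (r + 1) := by
  refine (𝒥.brillNoetherLocus_subset_succ P r).ssubset_of_ne fun heq => ?_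
  have h1 := 𝒥.topologicalKrullDim_brillNoetherLocus_eq_of_le_curveGenus hC P hr.le
  have h2 := 𝒥.topologicalKrullDim_brillNoetherLocus_eq_of_le_curveGenus hC P (Nat.succ_le_of_lt hr)
  rw [← heq, h1] at h2
  have : r = r + 1 := by exact_mod_cast h2
  omega

include hC in
/-- **Lange's Lemma 4.2.1 (i) over any algebraically closed field of characteristic `0`: `W̃_r(P) = J` for `r ≥ g(C) ≥ 1`** — `W̃_g(P)` is a
closed irreducible subset of dimension `g` (above) of the irreducible `J`, whose dimension is `g` (★ `Jacobian.dim_eq_curveGenus`, Milne Prop. 2.1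
via Weil's construction), hence all of `J` (★ `Topology.topologicalKrullDim_lt_of_isClosed_ssubset`); and `W̃` is monotone (★ `brillNoetherLocus_mono`).
(★ `brillNoetherLocus_eq_univ_of_dim_le` is the complex case.) [cite: Lange2023AbelianVarietiesComplex, §4.2.1 Lemma 4.2.1 (i)]
[cite: Milne1986JacobianVarieties, §5 Thm. 5.1 (a) and Prop. 2.1] -/
theorem brillNoetherLocus_eq_univ_of_curveGenus_le (hpos : 1 ≤ curveGenus C) {r : ℕ} (hr : curveGenus C ≤ r) :
    𝒥.brillNoetherLocus P r = Set.univ := by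
  have hdimJ : 𝒥.J.dim = curveGenus C := Jacobian.dim_eq_curveGenus C hC hpos 𝒥
  refine Set.eq_univ_of_univ_subset ((Set.univ_subset_iff.mpr ?_).trans (𝒥.brillNoetherLocus_mono P hr))
  by_contra hne
  have hlt := Literature.Topology.topologicalKrullDim_lt_of_isClosed_ssubset (X := 𝒥.J.X.left)
    (𝒥.isClosed_brillNoetherLocus P (curveGenus C)) hne (curveGenus C) (by
      rw [𝒥.J.topologicalKrullDim_left, hdimJ]
      exact_mod_cast Nat.lt_succ_self _)
  rw [𝒥.topologicalKrullDim_brillNoetherLocus_eq_of_le_curveGenus hC P le_rfl] at hlt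
  exact lt_irrefl _ hlt

include hC in
/-- **`f^{(r)} : C^{(r)} → J` is surjective on `K`-points for `r ≥ g(C) ≥ 1`** (Milne Thm. 5.1 (a) «`f^{(g)}` is surjective», any algebraically
closed field of characteristic `0`, any Jacobian, any base point): every `a ∈ J(K)` is an `r`-fold Abel sum `∏ⱼ f^P(τⱼ)` — `W̃_r(P) = J` and the
`K`-points of `W̃_r(P)` are the Abel sums (★ `pt_mem_brillNoetherLocus_iff`).  (★ `exists_tuple_prod_comp_abelJacobi_eq` is the complex case, with
Weil's data explicit.) [cite: Milne1986JacobianVarieties, §5 Thm. 5.1 (a)] -/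
theorem exists_tuple_prod_comp_abelJacobi_eq_of_curveGenus_le (hpos : 1 ≤ curveGenus C) {r : ℕ} (hr : curveGenus C ≤ r)
    (a : 𝒥.J.Points K) : ∃ τ : Fin r → AlgPoints C K, (∏ j : Fin r, τ j ≫ 𝒥.abelJacobi P) = a :=
  (𝒥.pt_mem_brillNoetherLocus_iff P r a).mp (by
    rw [𝒥.brillNoetherLocus_eq_univ_of_curveGenus_le hC P hpos hr]
    exact Set.mem_univ _)

end Jacobian

end Literature.AlgebraicGeometry.Motives

end
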